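/-
Copyright (c) 2026. All rights reserved.
Released under Apache 2.0 license as described in the file LICENSE.
Authors: abc-iut cell — seat abc-iut-f-060 (block F fact-proving wave, tranche 60 of plan/F-TRANCHES.tsv:
FACT-LIST rows F-0206 `CuspidalAlgorithm.RecoversCusps`, F-0207 `CuspidalData.DecompEqCommensuratorOfInertia`,
F-0208 `CuspidalData.NonProperIffFree` of `AbsTopIChains.lean`).
-/
import Literature.AnabelianGeometry.AbsoluteAnabelian.AbsTopIChains
import Literature.AnabelianGeometry.AbsoluteAnabelian.FundamentalExtensionNonVacuity
import Literature.AnabelianGeometry.Anabelioids.Basic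
import HarnessLib

/-!
# [AbsTopI] Lemma 4.5 (i), (v), (vi) as typed: universal closures refuted; the structure of (vi)

S. Mochizuki, *Topics in Absolute Anabelian Geometry I: Generalities* [MochizukiAbsTopI2012], Lemma 4.5
"Cuspidal decomposition groups" pp. 54–55 (kurims manuscript pagination): (i) "`X` is non-proper if and only if
every torsion-free pro-`Σ` open subgroup of `Δ` is free pro-`Σ`"; (v) "by allowing `H` to vary, this yields a
[group-theoretic] characterization of the decomposition groups of cusps in `Π`"; (vi) "Let `I ⊆ Π` be a
decomposition group of a cusp. Then `I = C_Π(I ∩ Δ)`".  The parent file `AbsTopIChains.lean` (abc-iut-L4-t4) types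
the three items as PREDICATES on abstract cuspidal data `C : CuspidalData E` over an abstract extension
`E : 1 → Δ → Π → G → 1` (typing policy θ: the étale-`π₁` model is not available, so the cusps enter as DATA).

This PROOF-ONLY companion file (no `def`, no `instance`, no `structure`; cell FACT-LIST rows F-0206 / F-0207 /
F-0208, kernel_closedness = parametrised) records three kernel facts about those predicates:

1. **Universal closures are FALSE (plan rule R5: a schema, not a 0-ary fact).**  `C` is free data on a fixed `E`:
   the cuspless datum and a single-cusp datum (`FundamentalExtensionNonVacuity.lean`) give contradictory instances,
   so `∀ E C, …` fails for each row — in the strong forms `∀ A E, ∃ C, ¬ A.RecoversCusps E C`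
   (`CuspidalAlgorithm.exists_not_recoversCusps`), `∀ E S, ∃ C, ¬ C.NonProperIffFree S`
   (`CuspidalData.exists_not_nonProperIffFree`, by excluded middle on the group-theoretic side of (i)), and
   `∀ E, Π ≠ 1 → ∃ C, ¬ C.DecompEqCommensuratorOfInertia` (`CuspidalData.exists_not_decompEqCommensuratorOfInertia`:
   one cusp with `D = 1`, whose commensurator is all of `Π`), plus the three closed negations `not_forall_…` at a
   two-element profinite group.  Consequence for consumers: each row may only be ASSUMED at a named instance
   `(E, C)` (the cuspidal data OF a curve), never as a closure.
2. **Structure theorem for (vi)** (`CuspidalData.decompEqCommensuratorOfInertia_iff`): for every cuspidal datum,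
   `D_x = C_Π(D_x ∩ Δ)` for all cusps `x` **if and only if** the inertia groups `I_x = D_x ∩ Δ` are commensurably
   terminal in `Δ` ([AbsAnab] Lemma 1.3.7 as typed: abc-iut-L4-t1's `CuspidalData.InertiaCommensurablyTerminal`,
   FACT-LIST F-0003) **and** `D_x = N_Π(I_x)` ([AbsTopIII] Thm 1.11 (b) as typed: `CuspidalData.DecompEqNormalizer`).
   Pure group theory (`Δ ⊴ Π`, `N ≤ C`, `C_Δ(I) = C_Π(I) ∩ Δ`); it makes the three assumption labels ONE label for
   any consumer.
3. Private folklore lemmas on Mathlib's `Subgroup.Commensurable.commensurator` (`C_G(1) = G`;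
   `C_K(I) = C_G(I) ∩ K` for `I ≤ K`); `H ≤ N_G(H) ≤ C_G(H)` are layer L3's `Anabelioids.le_commensurator` /
   `Anabelioids.normalizer_le_commensurator`, reused by name.

The POSITIVE content of F-0206 at a named instance — a functorial algorithm recovering the cusps of `(E, C)`
exists iff the cusp decomposition classes are characteristic for `Δ ⊴ Π` — is the sibling proof-only file
`AbsTopIChainsCuspidalAlgorithmExists.lean` (`CuspidalAlgorithm.exists_recoversCusps_iff`).

HONEST FRAMING: nothing of [AbsTopI] Lemma 4.5 is proved or refuted here AS A STATEMENT ABOUT CURVES — the refuted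
objects are the universal closures of the cell's typed predicates over free abstract data, and the structure
theorem is an equivalence between typed predicates.  A FACT-LIST row is an assumption label, not an endorsement;
no side is taken on [IUTchIII] Cor. 3.12; typed ≠ proved.
-/

namespace Literature.AnabelianGeometry.AbsoluteAnabelian

open scoped Pointwise

universe u

/-! ### Commensurators (folklore complements to `Mathlib.GroupTheory.Commensurable`) -/

section Commensurator

variable {G : Type u} [Group G]

/-- Conjugating a subgroup by `MulAut.conj g` (the parent files' `MulAut.conj g • D`) is conjugating by
`ConjAct.toConjAct g` (the form used by `Subgroup.Commensurable.commensurator`). [folklore] -/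
private theorem conj_smul_eq_toConjAct_smul' (g : G) (S : Subgroup G) :
    MulAut.conj g • S = ConjAct.toConjAct g • S := by
  ext x
  simp only [Subgroup.mem_smul_pointwise_iff_exists, ConjAct.smul_def, ConjAct.ofConjAct_toConjAct,
    MulAut.smul_def, MulAut.conj_apply]

/-- Membership in the commensurator `C_G(H)`, phrased with `MulAut.conj`: `g ∈ C_G(H)` iff `gHg⁻¹` and `H`
are commensurable. [folklore] -/
private theorem mem_commensurator_iff_conj (H : Subgroup G) (g : G) :
    g ∈ Subgroup.Commensurable.commensurator H ↔ Subgroup.Commensurable (MulAut.conj g • H) H := by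
  rw [Subgroup.Commensurable.commensurator_mem_iff, conj_smul_eq_toConjAct_smul']

/-- `C_G(1) = G`: every conjugate of the trivial subgroup is the trivial subgroup. [folklore] -/
private theorem commensurator_bot : Subgroup.Commensurable.commensurator (⊥ : Subgroup G) = ⊤ := by
  ext g
  simp only [Subgroup.Commensurable.commensurator_mem_iff, Subgroup.smul_bot, Subgroup.mem_top, iff_true]
  exact Subgroup.Commensurable.refl ⊥

/-- The commensurator computed inside an intermediate subgroup: for `I ≤ K ≤ G`,
`C_K(I) = C_G(I) ∩ K` (commensurability of `kIk⁻¹` and `I` does not depend on the ambient group). [folklore] -/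
private theorem commensurator_subgroupOf {I K : Subgroup G} (hIK : I ≤ K) :
    Subgroup.Commensurable.commensurator (I.subgroupOf K) =
      (Subgroup.Commensurable.commensurator I).subgroupOf K := by
  ext k
  rw [Subgroup.mem_subgroupOf, mem_commensurator_iff_conj, mem_commensurator_iff_conj,
    Subgroup.conj_smul_subgroupOf hIK k]
  have hle : MulAut.conj (k : G) • I ≤ K := Subgroup.conj_smul_le_of_le hIK k
  unfold Subgroup.Commensurable
  rw [Subgroup.relIndex_subgroupOf hIK, Subgroup.relIndex_subgroupOf hle]

end Commensurator

namespace FundamentalExtension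

variable (E : FundamentalExtension.{u})

/-! ### [AbsTopI] Lemma 4.5 (vi): the structure of `DecompEqCommensuratorOfInertia` -/

namespace CuspidalData

variable {E} (C : CuspidalData E)

/-- `I_x = D_x ∩ Δ` is normalised by `D_x`: `d (D_x ∩ Δ) d⁻¹ = D_x ∩ Δ` for `d ∈ D_x` (`Δ ⊴ Π`).
[cite: MochizukiAbsTopI2012, Lemma 4.5 (vi) p.55] -/
theorem conj_smul_inertia_eq_of_mem (x : C.Cusp) {d : E.arith} (hd : d ∈ C.Dcusp x) :
    MulAut.conj d • (C.Dcusp x ⊓ E.geom) = C.Dcusp x ⊓ E.geom := by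
  rw [Subgroup.smul_inf, Subgroup.conj_smul_eq_self_of_mem hd, Subgroup.Normal.conj_smul_eq_self]

/-- `D_x ≤ N_Π(D_x ∩ Δ)`. [cite: MochizukiAbsTopI2012, Lemma 4.5 (vi) p.55] -/
theorem Dcusp_le_normalizer_inertia (x : C.Cusp) :
    C.Dcusp x ≤ Subgroup.normalizer ((C.Dcusp x ⊓ E.geom : Subgroup E.arith) : Set E.arith) := by
  intro d hd
  rw [Subgroup.mem_normalizer_iff]
  intro h
  rw [← Subgroup.smul_mem_pointwise_smul_iff (a := MulAut.conj d) (x := h),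
    C.conj_smul_inertia_eq_of_mem x hd, MulAut.smul_def, MulAut.conj_apply]

/-- **(vi) ⇒ [AbsTopIII] Thm 1.11 (b) as typed**: if every decomposition group is the commensurator of its
inertia group, it is also its normaliser (`D_x ≤ N_Π(I_x) ≤ C_Π(I_x) = D_x`).
[cite: MochizukiAbsTopI2012, Lemma 4.5 (vi) p.55] -/
theorem decompEqNormalizer_of_decompEqCommensuratorOfInertia (h : C.DecompEqCommensuratorOfInertia) :
    C.DecompEqNormalizer := by
  intro x
  rw [C.Icusp_eq x]
  refine le_antisymm (C.Dcusp_le_normalizer_inertia x) ?_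
  calc Subgroup.normalizer ((C.Dcusp x ⊓ E.geom : Subgroup E.arith) : Set E.arith)
      ≤ Subgroup.Commensurable.commensurator (C.Dcusp x ⊓ E.geom) := Anabelioids.normalizer_le_commensurator _
    _ = C.Dcusp x := (h x).symm

/-- **(vi) ⇒ [AbsAnab] Lemma 1.3.7 as typed**: if `D_x = C_Π(I_x)` then `C_Δ(I_x) = C_Π(I_x) ∩ Δ = D_x ∩ Δ = I_x`,
i.e. the inertia groups are commensurably terminal in `Δ`. [cite: MochizukiAbsTopI2012, Lemma 4.5 (vi) p.55] -/
theorem inertiaCommensurablyTerminal_of_decompEqCommensuratorOfInertia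
    (h : C.DecompEqCommensuratorOfInertia) : C.InertiaCommensurablyTerminal := by
  intro x
  refine ⟨?_⟩
  rw [C.Icusp_eq x, commensurator_subgroupOf inf_le_right, ← h x]
  exact (Subgroup.inf_subgroupOf_right _ _).symm

/-- **[AbsAnab] Lemma 1.3.7 ∧ [AbsTopIII] Thm 1.11 (b) ⇒ (vi), as typed**: if `C_Δ(I_x) = I_x` and `D_x = N_Π(I_x)`,
then `D_x = C_Π(I_x)` — since `C_Π(I_x) ∩ Δ = C_Δ(I_x) = I_x` makes `I_x` normal in `C_Π(I_x)`, whence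
`C_Π(I_x) ≤ N_Π(I_x) = D_x ≤ C_Π(I_x)`. [cite: MochizukiAbsTopI2012, Lemma 4.5 (vi) p.55] -/
theorem decompEqCommensuratorOfInertia_of_inertiaCommensurablyTerminal_of_decompEqNormalizer
    (h₁ : C.InertiaCommensurablyTerminal) (h₂ : C.DecompEqNormalizer) :
    C.DecompEqCommensuratorOfInertia := by
  intro x
  set I : Subgroup E.arith := C.Dcusp x ⊓ E.geom with hI
  set K : Subgroup E.arith := Subgroup.Commensurable.commensurator I with hK
  have hIx : C.Icusp x = I := C.Icusp_eq x
  -- (1) `K ∩ Δ = I`: by Lemma 1.3.7 inside `Δ` and `I ≤ K`.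
  have hKΔ : K ⊓ E.geom = I := by
    apply le_antisymm
    · intro k hk
      have hk' : (⟨k, hk.2⟩ : E.geom) ∈ Subgroup.Commensurable.commensurator (I.subgroupOf E.geom) := by
        rw [commensurator_subgroupOf inf_le_right, Subgroup.mem_subgroupOf]
        exact hk.1
      have h137 := (h₁ x).commensurator_eq
      rw [hIx] at h137
      rw [h137, Subgroup.mem_subgroupOf] at hk'
      exact hk'
    · exact le_inf (Anabelioids.le_commensurator I) inf_le_right
  -- (2) `D = N(I) ≤ K` and `K ≤ N(I) = D`.
  apply le_antisymm
  · calc C.Dcusp x = Subgroup.normalizer (I : Set E.arith) := by rw [h₂ x, hIx]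
      _ ≤ K := Anabelioids.normalizer_le_commensurator I
  · intro k hk
    rw [h₂ x, hIx, Subgroup.mem_normalizer_iff]
    intro h
    have hkI : MulAut.conj k • I = I := by
      rw [← hKΔ, Subgroup.smul_inf, Subgroup.conj_smul_eq_self_of_mem hk, Subgroup.Normal.conj_smul_eq_self]
    rw [← Subgroup.smul_mem_pointwise_smul_iff (a := MulAut.conj k) (x := h), hkI, MulAut.smul_def,
      MulAut.conj_apply]

/-- **STRUCTURE THEOREM for [AbsTopI] Lemma 4.5 (vi) as typed** (FACT-LIST F-0207): for every cuspidal datum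
`C` on every extension `E`, `D_x = C_Π(D_x ∩ Δ)` for all cusps `x` iff the inertia groups are commensurably
terminal in `Δ` ([AbsAnab] Lemma 1.3.7 as typed, F-0003) and each `D_x` is the normaliser of its inertia group
([AbsTopIII] Thm 1.11 (b) as typed). [cite: MochizukiAbsTopI2012, Lemma 4.5 (vi) p.55] -/
theorem decompEqCommensuratorOfInertia_iff :
    C.DecompEqCommensuratorOfInertia ↔ C.InertiaCommensurablyTerminal ∧ C.DecompEqNormalizer :=
  ⟨fun h => ⟨C.inertiaCommensurablyTerminal_of_decompEqCommensuratorOfInertia h,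
    C.decompEqNormalizer_of_decompEqCommensuratorOfInertia h⟩,
    fun h => C.decompEqCommensuratorOfInertia_of_inertiaCommensurablyTerminal_of_decompEqNormalizer h.1 h.2⟩

/-! ### Universal closures refuted (plan rule R5): the three rows are schemata over free cuspidal data -/

/-- The cuspless cuspidal datum (the proper case), with its emptiness exposed.
[cite: MochizukiAbsTopI2012, Lemma 4.5 (i) p.54] -/
theorem exists_isEmpty_cusp (E : FundamentalExtension.{u}) : ∃ C : CuspidalData E, IsEmpty C.Cusp :=
  ⟨{ Cusp := PEmpty.{u + 1}
     Dcusp := fun x => x.elim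
     Icusp := fun x => x.elim
     Icusp_eq := fun x => x.elim
     isClosed_Dcusp := fun x => x.elim
     eq_of_conj := fun x => x.elim }, inferInstanceAs (IsEmpty PEmpty.{u + 1})⟩

/-- A single-cusp cuspidal datum with decomposition group ALL of `Π` (closed).
[cite: MochizukiAbsTopI2012, Lemma 4.5 (v) p.55] -/
theorem exists_single_top (E : FundamentalExtension.{u}) :
    ∃ C : CuspidalData E, Nonempty C.Cusp ∧ ∀ x, C.Dcusp x = ⊤ := by
  obtain ⟨C, ⟨e⟩, hC⟩ :=
    CuspidalData.nonempty_single E ⊤ (by rw [Subgroup.coe_top]; exact isClosed_univ)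
  exact ⟨C, ⟨e.symm PUnit.unit⟩, hC⟩

/-- A single-cusp cuspidal datum with TRIVIAL decomposition group (closed: `Π` is Hausdorff).
[cite: MochizukiAbsTopI2012, Lemma 4.5 (vi) p.55] -/
theorem exists_single_bot (E : FundamentalExtension.{u}) :
    ∃ C : CuspidalData E, Nonempty C.Cusp ∧ ∀ x, C.Dcusp x = ⊥ := by
  obtain ⟨C, ⟨e⟩, hC⟩ :=
    CuspidalData.nonempty_single E ⊥ (by rw [Subgroup.coe_bot]; exact isClosed_singleton)
  exact ⟨C, ⟨e.symm PUnit.unit⟩, hC⟩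

/-- **F-0207 is a schema (strong form)**: over every extension with `Π ≠ 1` some cuspidal datum violates (vi) as
typed — one cusp with `D = 1`, for which `C_Π(D ∩ Δ) = C_Π(1) = Π ≠ 1 = D`.
[cite: MochizukiAbsTopI2012, Lemma 4.5 (vi) p.55] -/
theorem exists_not_decompEqCommensuratorOfInertia (E : FundamentalExtension.{u}) [Nontrivial E.arith] :
    ∃ C : CuspidalData E, ¬ C.DecompEqCommensuratorOfInertia := by
  obtain ⟨C, ⟨x⟩, hC⟩ := exists_single_bot E
  refine ⟨C, fun h => ?_⟩
  have hx := h x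
  rw [hC x, bot_inf_eq, commensurator_bot] at hx
  exact bot_ne_top hx

/-- **F-0208 is a schema (strong form)**: over every extension and for every prime set `Σ`, some cuspidal datum
violates (i) as typed — the group-theoretic side of (i) depends on `(E, Σ)` only, while the cuspless datum and a
single-cusp datum give both truth values on the cusp side (excluded middle; the group-theoretic side is not
evaluated). [cite: MochizukiAbsTopI2012, Lemma 4.5 (i) p.54] -/
theorem exists_not_nonProperIffFree (E : FundamentalExtension.{u}) (S : Set ℕ) :
    ∃ C : CuspidalData E, ¬ C.NonProperIffFree S := by
  by_cases hR : ∀ H : Subgroup E.arith, H ≤ E.geom → IsOpen ((H.subgroupOf E.geom : Set E.geom)) →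
      (∀ g : H, IsOfFinOrder g → g = 1) → IsProSet H S → IsFreePro H S
  · obtain ⟨C, hC⟩ := exists_isEmpty_cusp E
    exact ⟨C, fun h => (not_nonempty_iff.mpr hC) (h.mpr hR)⟩
  · obtain ⟨C, hne, -⟩ := exists_single_top E
    exact ⟨C, fun h => hR (h.mp hne)⟩

end CuspidalData

/-- **F-0206 is a schema (strong form)**: for EVERY cuspidal algorithm `A` and every extension `E` some cuspidal
datum on `E` is not recovered — the cuspless datum needs `A.out E = ∅`, a single-cusp datum with `D = Π` needs
`Π ∈ A.out E`.  (So no algorithm recovers the cusps of all cuspidal data: `C` must be THE cusp data of the curve.)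
[cite: MochizukiAbsTopI2012, Lemma 4.5 (v) p.55] -/
theorem CuspidalAlgorithm.exists_not_recoversCusps (A : CuspidalAlgorithm.{u}) (E : FundamentalExtension.{u}) :
    ∃ C : CuspidalData E, ¬ A.RecoversCusps E C := by
  by_cases hA : A.out E = ∅
  · obtain ⟨C, ⟨x⟩, -⟩ := CuspidalData.exists_single_top E
    refine ⟨C, fun h => ?_⟩
    have hx : C.Dcusp x ∈ ⋃ y : C.Cusp, C.decompositionClass y :=
      Set.mem_iUnion.mpr ⟨x, C.Dcusp_mem_decompositionClass x⟩
    have h' : A.out E = ⋃ y : C.Cusp, C.decompositionClass y := h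
    rw [← h', hA] at hx
    exact hx
  · obtain ⟨C, hC⟩ := CuspidalData.exists_isEmpty_cusp E
    refine ⟨C, fun h => hA ?_⟩
    have h' : A.out E = ⋃ y : C.Cusp, C.decompositionClass y := h
    rw [h']
    exact Set.iUnion_of_empty _

/-! ### The three closed negations (instantiate at the two-element profinite group `ℤ/2 → ℤ/2`) -/

/-- The extension `ℤ/2 =id⇒ ℤ/2` (`Δ = 1`, `Π = ℤ/2 ≠ 1`, discrete), used to close the three negations.
[cite: MochizukiAbsTopI2012, Lemma 4.5 p.54] -/
theorem exists_nontrivial_arith : ∃ E : FundamentalExtension.{u}, Nontrivial E.arith :=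
  ⟨{ arith := ProfiniteGrp.ofFiniteGrp (FiniteGrp.of (ULift.{u} (Multiplicative (ZMod 2))))
     gal := ProfiniteGrp.ofFiniteGrp (FiniteGrp.of (ULift.{u} (Multiplicative (ZMod 2))))
     aug := ContinuousMonoidHom.id _
     aug_surjective := Function.surjective_id },
    inferInstanceAs (Nontrivial (ULift.{u} (Multiplicative (ZMod 2))))⟩

/-- **The universal closure of F-0207 is false.** [cite: MochizukiAbsTopI2012, Lemma 4.5 (vi) p.55] -/
theorem CuspidalData.not_forall_decompEqCommensuratorOfInertia :
    ¬ ∀ (E : FundamentalExtension.{u}) (C : CuspidalData E), C.DecompEqCommensuratorOfInertia := by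
  intro h
  obtain ⟨E, hE⟩ := exists_nontrivial_arith.{u}
  obtain ⟨C, hC⟩ := CuspidalData.exists_not_decompEqCommensuratorOfInertia E
  exact hC (h E C)

/-- **The universal closure of F-0208 is false.** [cite: MochizukiAbsTopI2012, Lemma 4.5 (i) p.54] -/
theorem CuspidalData.not_forall_nonProperIffFree :
    ¬ ∀ (E : FundamentalExtension.{u}) (C : CuspidalData E) (S : Set ℕ), C.NonProperIffFree S := by
  intro h
  obtain ⟨E, -⟩ := exists_nontrivial_arith.{u}
  obtain ⟨C, hC⟩ := CuspidalData.exists_not_nonProperIffFree E ∅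
  exact hC (h E C ∅)

/-- **The universal closure of F-0206 is false.** [cite: MochizukiAbsTopI2012, Lemma 4.5 (v) p.55] -/
theorem CuspidalAlgorithm.not_forall_recoversCusps :
    ¬ ∀ (A : CuspidalAlgorithm.{u}) (E : FundamentalExtension.{u}) (C : CuspidalData E),
      A.RecoversCusps E C := by
  intro h
  -- the empty algorithm (genuine for proper curves)
  let A : CuspidalAlgorithm.{u} :=
    { out := fun _ => ∅
      isClosed_of_mem := fun _ _ h => h.elim
      conj_mem := fun _ _ _ h => h.elim
      transport := fun _ _ _ _ => (Set.image_empty _).symm }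
  obtain ⟨E, -⟩ := exists_nontrivial_arith.{u}
  obtain ⟨C, hC⟩ := A.exists_not_recoversCusps E
  exact hC (h A E C)

end FundamentalExtension

end Literature.AnabelianGeometry.AbsoluteAnabelian
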